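import Summits.BirchSwinnertonDyer.BirchSwinnertonDyer.Theorems.ByReductionTypeAtTwoMultUpperHalfTowerKernelDoors
import Summits.BirchSwinnertonDyer.BirchSwinnertonDyer.Theorems.ByReductionTypeAtTwoMultTowerClass100342a
import Summits.BirchSwinnertonDyer.BirchSwinnertonDyer.Theorems.ByReductionTypeAtTwoMultTowerClass308502r
import Summits.BirchSwinnertonDyer.BirchSwinnertonDyer.Theorems.ByReductionTypeAtTwoMultTowerClass439254c
import HarnessLib

/-!
# Route `ByReductionTypeAtTwo`, crux `MultUpperHalfAtTwo` (item stmt-BirchSwinnertonDyer-19922): three filed TOWER-gap certificates re-proved through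
# the ALL-KERNEL doors `MultTowerKernel.…` — `O1.TowerGapAtTwo` from the layer Selmer counts ALONE (demonstrator / positive control)

HONEST FRAMING (cell `bsd-2adic`, run/shared/lean/pub/bsd-2adic/, seat `bsd-2adic-tower-1` GEN 10, HUMAN RULINGS D-0036 / D-0054 / D-0074): research
route; THEOREMS ONLY; nothing is booked; no class closes here (the TOWER gap is one leg of a class's BSD₂ display; the Kato/descent legs are
untouched); BSD is not proved by any of this. For one class of each kind — `100342a1` (NON-SPLIT at `2`, two bits), `308502r1` (SPLIT, one bit),
`439254c1` (SPLIT with Tate unit `≡ 3 (mod 8)`, zero bits) — the tower gap filed by the generator lanes (`towerGapAtTwo_<label>_l<jj'>` in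
`…MultTowerClass<label>.lean`, displaying PRINT `h33g`/`hM`/`hA` + `hNS2` / `hSP1` / `hSP, hBDGP, Dq, hkq`) is re-proved with the SAME layer-count
hypotheses `hlow`/`hup` and the SAME margin `had`, and NO OTHER HYPOTHESIS, through `MultTowerKernel.towerGapAtTwo_of_layerSelmer_cert_nonsplitTwo /
_splitTwo_oneBit / _splitTwo_zeroBit` (`…MultUpperHalfTowerKernelDoors.lean`). Template for the generator lanes; the per-class decidable data
(`mult_two_`, `nonsplit_two_`, `split_two_`, `not_two_dvd_torsionOrder_`, `mem_P_of_dvd_`, `hasMultiplicativeReductionAtPrime_`, `minimalDiscriminantInt_`)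
are the class files' own theorems. References: R. Greenberg, LNM 1716 (1999) §3; Cremona's tables.
-/

set_option autoImplicit false
-- the Theorems namespace of this sub repeats the summit name by design (D-0017 nested layout: Summit.<S>.<Sub>)
set_option linter.dupNamespace false

noncomputable section

open scoped Classical

open NumberField IsDedekindDomain WeierstrassCurve Literature.NumberTheory.EllipticCurves
  Literature.NumberTheory.EllipticCurves.Greenberg1999
  Summit.BirchSwinnertonDyer.Rank1Residual.X5 Summit.BirchSwinnertonDyer.Rank1Residual.X5.O1
  Summit.BirchSwinnertonDyer.Rank1Residual.X5.Instances
  Summit.BirchSwinnertonDyer.Rank1Residual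
  Summit.BirchSwinnertonDyer.BirchSwinnertonDyer.Theorems.MultTowerClass

namespace Summit.BirchSwinnertonDyer.BirchSwinnertonDyer.Theorems.MultTowerKernel

/-- **`100342a1` (non-split multiplicative at `2`), pair `(0,3)`, ALL-KERNEL**: the tower gap from the two layer counts and the margin
`d + 0 + 3 ≤ 7 + a` only (cf. `MultTowerClass.towerGapAtTwo_100342a1_l03`, which displays `h33g hM hA hNS2`).
[cite: GreenbergLNM1716, §3 Lemmas 3.3–3.5 (PDF pp. 86–90) and pp. 90–93] -/
theorem demo_towerGapAtTwo_100342a1_l03 {a d : ℕ}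
    (hlow : ∀ κ : ZpExtension ℚ 2, κ.IsCyclotomic →
      2 ^ a ≤ Nat.card {z : c100342a1.selmerLayer κ 0 // 2 • z = 0})
    (hup : ∀ κ : ZpExtension ℚ 2, κ.IsCyclotomic →
      Nat.card {z : c100342a1.selmerLayer κ 3 // 2 • z = 0} ≤ 2 ^ d)
    (had : d + 0 + 3 ≤ 7 + a) : TowerGapAtTwo c100342a1 := by
  refine towerGapAtTwo_of_layerSelmer_cert_nonsplitTwo c100342a1 mult_two_100342a1 nonsplit_two_100342a1
    not_two_dvd_torsionOrder_100342a1 (j := 0) (j' := 3) (by norm_num) {11, 4561} ?_ mem_P_of_dvd_100342a1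
    (fun ℓ ↦ 1) (fun ℓ ↦ if ℓ = 4561 then 2 else 0) (fun ℓ ↦ 1) ?_ (fun ℓ _ hℓ ↦ ?_) hlow hup ?_
  · intro ℓ hℓ
    simp only [Finset.mem_insert, Finset.mem_singleton] at hℓ
    rcases hℓ with rfl | rfl <;> exact ⟨by norm_num, by norm_num⟩
  · intro ℓ hℓ
    simp only [Finset.mem_insert, Finset.mem_singleton] at hℓ
    rcases hℓ with rfl | rfl <;> norm_num
  · simp only [Finset.mem_insert, Finset.mem_singleton] at hℓ
    rcases hℓ with rfl | rfl
    · refine Or.inr (Or.inr (Or.inl ⟨hasMultiplicativeReductionAtPrime_100342a1 11 (Or.inl rfl), ?_, ?_, by norm_num, by norm_num⟩))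
      · rw [minimalDiscriminantInt_100342a1]; norm_num
      · rw [minimalDiscriminantInt_100342a1]; norm_num
    · refine Or.inr (Or.inr (Or.inl ⟨hasMultiplicativeReductionAtPrime_100342a1 4561 (Or.inr (rfl)), ?_, ?_, by norm_num, by norm_num⟩))
      · rw [minimalDiscriminantInt_100342a1]; norm_num
      · rw [minimalDiscriminantInt_100342a1]; norm_num
  · have hP : ∏ ℓ ∈ ({11, 4561} : Finset ℕ), (fun ℓ ↦ 1) ℓ ^ 2 ^ min 3 ((fun ℓ ↦ if ℓ = 4561 then 2 else 0) ℓ) = 2 ^ 0 := by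
      decide
    rw [hP, show (2 : ℕ) ^ 3 - 2 ^ 0 + a = 7 + a by norm_num]
    exact TowerClass.two_pow_mul_four_mul_two_pow_lt had

/-- **`308502r1` (split multiplicative at `2`, `k_q = 8`), pair `(0,3)`, ALL-KERNEL, ONE bit at `2`**: the tower gap from the two layer counts
and the margin `d + 1 + 3 + 1 ≤ 7 + a` only (cf. `MultTowerClass.towerGapAtTwo_308502r1_l03`, which displays `h33g hM hA hSP1`).
[cite: GreenbergLNM1716, §3 Lemmas 3.3–3.5 (PDF pp. 86–90) and pp. 90–93] -/
theorem demo_towerGapAtTwo_308502r1_l03 {a d : ℕ}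
    (hlow : ∀ κ : ZpExtension ℚ 2, κ.IsCyclotomic →
      2 ^ a ≤ Nat.card {z : c308502r1.selmerLayer κ 0 // 2 • z = 0})
    (hup : ∀ κ : ZpExtension ℚ 2, κ.IsCyclotomic →
      Nat.card {z : c308502r1.selmerLayer κ 3 // 2 • z = 0} ≤ 2 ^ d)
    (had : d + 1 + 3 + 1 ≤ 7 + a) : TowerGapAtTwo c308502r1 := by
  refine towerGapAtTwo_of_layerSelmer_cert_splitTwo_oneBit c308502r1 split_two_308502r1
    not_two_dvd_torsionOrder_308502r1 (j := 0) (j' := 3) (by norm_num) {3, 29, 197} ?_ mem_P_of_dvd_308502r1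
    (fun ℓ ↦ if ℓ = 3 then 4 else if ℓ = 29 then 2 else 1) (fun ℓ ↦ 0) (fun ℓ ↦ 1) ?_ (fun ℓ _ hℓ ↦ ?_) hlow hup ?_
  · intro ℓ hℓ
    simp only [Finset.mem_insert, Finset.mem_singleton] at hℓ
    rcases hℓ with rfl | rfl | rfl <;> exact ⟨by norm_num, by norm_num⟩
  · intro ℓ hℓ
    simp only [Finset.mem_insert, Finset.mem_singleton] at hℓ
    rcases hℓ with rfl | rfl | rfl <;> norm_num
  · simp only [Finset.mem_insert, Finset.mem_singleton] at hℓ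
    rcases hℓ with rfl | rfl | rfl
    · exact Or.inl (by norm_num)
    · exact Or.inr (Or.inl ⟨hasMultiplicativeReductionAtPrime_308502r1 29 (Or.inl rfl), by norm_num⟩)
    · refine Or.inr (Or.inr (Or.inl ⟨hasMultiplicativeReductionAtPrime_308502r1 197 (Or.inr (rfl)), ?_, ?_, by norm_num, by norm_num⟩))
      · rw [minimalDiscriminantInt_308502r1]; norm_num
      · rw [minimalDiscriminantInt_308502r1]; norm_num
  · have hP : ∏ ℓ ∈ ({3, 29, 197} : Finset ℕ), (fun ℓ ↦ if ℓ = 3 then 4 else if ℓ = 29 then 2 else 1) ℓ ^ 2 ^ min 3 ((fun ℓ ↦ 0) ℓ) = 2 ^ 3 := by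
      decide
    rw [hP, show (2 : ℕ) ^ 3 - 2 ^ 0 + a = 7 + a by norm_num,
      show (2 : ℕ) ^ d * 2 * 2 ^ 3 = 2 ^ (d + 1 + 3) by ring]
    exact Nat.pow_lt_pow_right (by norm_num) (by omega)

/-- **`439254c1` (split multiplicative at `2`, Tate unit `≡ 3 (mod 8)`, `k_q = 0`), pair `(1,3)`, ALL-KERNEL, ZERO bits at `2`**: the Tate-unit datum
`Δ_min = 2^7 · (−4666622055651157670469)`, `c₄ = 6713671185`, `u·c ≡ 3 (mod 8)`. [cite: CremonaAlgorithms1997, Table 1] -/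
theorem tateUnit_439254c1 : ∃ (k : ℕ) (u c : ℤ), c439254c1.minimalDiscriminantInt = 2 ^ k * u ∧ c439254c1.c₄ = (c : ℚ) ∧
    (u * c % 8 = 3 ∨ u * c % 8 = 5) :=
  ⟨7, -4666622055651157670469, 6713671185, by rw [minimalDiscriminantInt_439254c1]; norm_num,
    by rw [baseChange_int_c₄, M439254c1_c₄], by norm_num⟩

/-- **`439254c1`, pair `(1,3)`, ALL-KERNEL, ZERO bits at `2`**: the tower gap from the two layer counts and the margin `d + 0 + 4 + 1 ≤ 6 + a` only
(cf. `MultTowerClass.towerGapAtTwo_439254c1_l13`, which displays `h33g hM hA hSP hBDGP Dq hkq`).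
[cite: GreenbergLNM1716, §3 Lemmas 3.3–3.5 (PDF pp. 86–90) and pp. 90–93] -/
theorem demo_towerGapAtTwo_439254c1_l13 {a d : ℕ}
    (hlow : ∀ κ : ZpExtension ℚ 2, κ.IsCyclotomic →
      2 ^ a ≤ Nat.card {z : c439254c1.selmerLayer κ 1 // 2 • z = 0})
    (hup : ∀ κ : ZpExtension ℚ 2, κ.IsCyclotomic →
      Nat.card {z : c439254c1.selmerLayer κ 3 // 2 • z = 0} ≤ 2 ^ d)
    (had : d + 0 + 4 + 1 ≤ 6 + a) : TowerGapAtTwo c439254c1 := by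
  refine towerGapAtTwo_of_layerSelmer_cert_splitTwo_zeroBit c439254c1 split_two_439254c1 tateUnit_439254c1
    not_two_dvd_torsionOrder_439254c1 (j := 1) (j' := 3) (by norm_num) {3, 23, 1061} ?_ mem_P_of_dvd_439254c1
    (fun ℓ ↦ if ℓ = 3 then 4 else if ℓ = 23 then 2 else 1) (fun ℓ ↦ if ℓ = 23 then 1 else 0) (fun ℓ ↦ if ℓ = 1061 then 5 else 1) ?_
    (fun ℓ _ hℓ ↦ ?_) hlow hup ?_
  · intro ℓ hℓ
    simp only [Finset.mem_insert, Finset.mem_singleton] at hℓ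
    rcases hℓ with rfl | rfl | rfl <;> exact ⟨by norm_num, by norm_num⟩
  · intro ℓ hℓ
    simp only [Finset.mem_insert, Finset.mem_singleton] at hℓ
    rcases hℓ with rfl | rfl | rfl <;> norm_num
  · simp only [Finset.mem_insert, Finset.mem_singleton] at hℓ
    rcases hℓ with rfl | rfl | rfl
    · exact Or.inl (by norm_num)
    · exact Or.inr (Or.inl ⟨hasMultiplicativeReductionAtPrime_439254c1 23 (Or.inl rfl), by norm_num⟩)
    · refine Or.inr (Or.inr (Or.inl ⟨hasMultiplicativeReductionAtPrime_439254c1 1061 (Or.inr (rfl)), ?_, ?_, by norm_num, by norm_num⟩))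
      · rw [minimalDiscriminantInt_439254c1]; norm_num
      · rw [minimalDiscriminantInt_439254c1]; norm_num
  · have hP : ∏ ℓ ∈ ({3, 23, 1061} : Finset ℕ), (fun ℓ ↦ if ℓ = 3 then 4 else if ℓ = 23 then 2 else 1) ℓ ^ 2 ^ min 3 ((fun ℓ ↦ if ℓ = 23 then 1 else 0) ℓ) = 2 ^ 4 := by
      decide
    rw [hP, show (2 : ℕ) ^ 3 - 2 ^ 1 + a = 6 + a by norm_num, ← pow_add]
    exact Nat.pow_lt_pow_right (by norm_num) (by omega)

end Summit.BirchSwinnertonDyer.BirchSwinnertonDyer.Theorems.MultTowerKernel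

end
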